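import Summits.QuantumFields.BalabanUV.Beta.WilsonWardSocketFit
import Summits.QuantumFields.BalabanUV.Beta.ColourBasisSU

/-!
# `BalabanUV.Beta.WilsonWardColourFree` — row D1, (L4) W-side: the hW Wilson binders at `T_W = (8N²)⁻¹ • wsym22 N` (`WilsonWardSocketFit`) with the
# colour-basis binders `(hτ, ho, c)` DISCHARGED for every `SU(N)`, `2 ≤ N` (β sub-cell, unit `b2b-balaban-beta-an3`, GEN 32, step S3f)

HONEST FRAMING (cell charter, verbatim): «discharging `BetaPertH` makes Bałaban's UV stability UNCONDITIONAL — a real constructive-QFT result;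
it is NOT the continuum limit and NOT the Clay problem.»  HONEST DEPENDENCY (cell records, verbatim): «continuum YM on T⁴ ⇐ BetaPertH ∧ nine spine
estimates (0/9 proved); BetaPertH ⇐ (D1) ∧ (D4) ∧ CAP+tail; G-an2-4 gates asym, D1 and NE2/3/4.»  DERIVED cell leaf: nothing cited — every statement
is kernel-proved here ([folklore]); no `[cite:]` tag, no `def`.  By itself this file instantiates NO binder of the β-function wall.  NOT D1, NOT
`BetaPertH`, NOT continuum, NOT Clay.

ABSOLUTE RULE (cell charter, verbatim): «No internally-minted statement may enter as a cited fact. Every hypothesis is either kernel-proved in this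
package or a verbatim quotation of a PUBLISHED theorem with page reference. The manuscript(s) under audit are NOT citable for their own disputed
steps — they are the thing under adjudication; programme-internal (2001/route/tribunal) claims are never citable.»

## What

The statements of `WilsonWardSocketFit.hWil_wilson_TW` / `hWil''_wilson_TW` (and their `d = 3` forms) do not mention the colour basis: `τ : C → 𝔲(N)`
with `Complete τ`, `TrOrthonormal τ` and an index `c : C` are AUXILIARY data of leaf-09's proof.  With the trace-orthonormal complete basis
`ColourBasisSU.suGen N` (`√N ·` generalized Gell-Mann; `suGen_complete`, `suGen_trOrthonormal`) and the index `ColourBasisSU.diagIndex` these binders are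
discharged once and for all: **`hWil_wilson_TW_su`**, **`hWil''_wilson_TW_su`**, **`hWil_wilson_TW₃_su`**, **`hWil''_wilson_TW₃_su`** — hypotheses
`2 ≤ N`, the blocking `Lc`, the root `r` and the hW pin only.  Twin of `WilsonLetterColourFree` (the hR side).

NOT HERE: anything about the border / mixed letters, the assembly, any statement of Bałaban's papers.

Provenance: pub-balaban β sub-cell, unit `b2b-balaban-beta-an3` GEN 32, 2026-08-20 (v1); over `WilsonWardSocketFit` and `ColourBasisSU` BY NAME; no
existing file touched.
-/

namespace Summit.QuantumFields.BalabanUV.Beta.WilsonWardColourFree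

open Finset
open scoped BigOperators
open Literature.MathematicalPhysics.QuantumFieldTheory.Balaban1983to89
open Literature.MathematicalPhysics.QuantumFieldTheory.Balaban1983to89.Beta
open WilsonVertex2Sym (wsym22)
open WilsonBiStencil (wilsonW₂)
open StepJetData (wilsonA)
open ExpKernelCalculus (MKer comp)
open OneStepResolventKernel (Fib)
open KernelWard (divV)
open AffineAveraging (box toSite)
open Summit.QuantumFields.BalabanUV.Beta.BorderedHessian (diagK stepScale)
open Summit.QuantumFields.BalabanUV.Beta.AveragingWardRootedStencils (legInd)
open Summit.QuantumFields.BalabanUV.Beta.ColourBasisSU (suGen suGen_complete suGen_trOrthonormal diagIndex ne_zero_of_two_le)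
open Summit.QuantumFields.BalabanUV.Beta.WilsonWardSocketFit (hWil_wilson_TW hWil''_wilson_TW hWil_wilson_TW₃ hWil''_wilson_TW₃)

variable {d : ℕ} {N : ℕ}

/-- [folklore] **`hWil` AT `T_W`, COLOUR-FREE**: the hW Wilson binder of `WardLocusRecursiveAll.divW_WrecAt_zero_of_letters` at `T := (8N²)⁻¹ • wsym22 N`,
`RW := 0`, for every `SU(N)`, `2 ≤ N`, under the hW pin `cE₂ = Lc^{2(d+1)}`. -/
theorem hWil_wilson_TW_su (hN : 2 ≤ N) (Lc : ℕ) [NeZero Lc] (r : Fin (d + 1) → ℕ) {cE₂ : ℝ} (hcE₂ : cE₂ = (Lc : ℝ) ^ (2 * (d + 1))) :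
    ∀ (Y : Fin (d + 1) → ℤ) (κ' : Fin (d + 1)) (u' : Fin (d + 1) → ℤ),
      (stepScale d Lc 0 * (Lc : ℝ) ^ (d + 1))⁻¹ • ∑ v ∈ box (d + 1) Lc,
          divV (fun κ u => cE₂ • wilsonW₂ d ((8 * (N : ℝ) ^ 2)⁻¹ • wsym22 N) κ u κ' u') ((Lc : ℤ) • Y + toSite v) =
        comp (((Lc : ℝ) ^ (d + 1)) • wilsonA d κ' u') (diagK (((1 : ℝ) / 2) • ∑ v ∈ box (d + 1) Lc, legInd (toSite r) ((Lc : ℤ) • Y + toSite v)))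
          - comp (diagK (((1 : ℝ) / 2) • ∑ v ∈ box (d + 1) Lc, legInd (toSite r) ((Lc : ℤ) • Y + toSite v))) (((Lc : ℝ) ^ (d + 1)) • wilsonA d κ' u')
          + (0 : (Fin (d + 1) → ℤ) → Fin (d + 1) → (Fin (d + 1) → ℤ) → MKer (d + 1) (Fib d)) Y κ' u' :=
  hWil_wilson_TW (suGen_complete (ne_zero_of_two_le hN)) (suGen_trOrthonormal N) (ne_zero_of_two_le hN) (diagIndex hN) Lc r hcE₂

/-- [folklore] **`hWil''` AT `T_W`, COLOUR-FREE** (second background slot), every `SU(N)`, `2 ≤ N`. -/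
theorem hWil''_wilson_TW_su (hN : 2 ≤ N) (Lc : ℕ) [NeZero Lc] (r : Fin (d + 1) → ℕ) {cE₂ : ℝ} (hcE₂ : cE₂ = (Lc : ℝ) ^ (2 * (d + 1))) :
    ∀ (Y : Fin (d + 1) → ℤ) (κ : Fin (d + 1)) (u : Fin (d + 1) → ℤ),
      (stepScale d Lc 0 * (Lc : ℝ) ^ (d + 1))⁻¹ • ∑ v ∈ box (d + 1) Lc,
          divV (fun κ' u' => cE₂ • wilsonW₂ d ((8 * (N : ℝ) ^ 2)⁻¹ • wsym22 N) κ u κ' u') ((Lc : ℤ) • Y + toSite v) =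
        comp (((Lc : ℝ) ^ (d + 1)) • wilsonA d κ u) (diagK (((1 : ℝ) / 2) • ∑ v ∈ box (d + 1) Lc, legInd (toSite r) ((Lc : ℤ) • Y + toSite v)))
          - comp (diagK (((1 : ℝ) / 2) • ∑ v ∈ box (d + 1) Lc, legInd (toSite r) ((Lc : ℤ) • Y + toSite v))) (((Lc : ℝ) ^ (d + 1)) • wilsonA d κ u)
          + (0 : (Fin (d + 1) → ℤ) → Fin (d + 1) → (Fin (d + 1) → ℤ) → MKer (d + 1) (Fib d)) Y κ u :=
  hWil''_wilson_TW (suGen_complete (ne_zero_of_two_le hN)) (suGen_trOrthonormal N) (ne_zero_of_two_le hN) (diagIndex hN) Lc r hcE₂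

/-- [folklore] `d = 3`, pin `cE₂ = Lc⁸`, colour-free: `hWil` at `T_W`. -/
theorem hWil_wilson_TW₃_su (hN : 2 ≤ N) (Lc : ℕ) [NeZero Lc] (r : Fin 4 → ℕ) {cE₂ : ℝ} (hcE₂ : cE₂ = (Lc : ℝ) ^ 8) :
    ∀ (Y : Fin 4 → ℤ) (κ' : Fin 4) (u' : Fin 4 → ℤ),
      (stepScale 3 Lc 0 * (Lc : ℝ) ^ (3 + 1))⁻¹ • ∑ v ∈ box (3 + 1) Lc,
          divV (fun κ u => cE₂ • wilsonW₂ 3 ((8 * (N : ℝ) ^ 2)⁻¹ • wsym22 N) κ u κ' u') ((Lc : ℤ) • Y + toSite v) =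
        comp (((Lc : ℝ) ^ (3 + 1)) • wilsonA 3 κ' u') (diagK (((1 : ℝ) / 2) • ∑ v ∈ box (3 + 1) Lc, legInd (toSite r) ((Lc : ℤ) • Y + toSite v)))
          - comp (diagK (((1 : ℝ) / 2) • ∑ v ∈ box (3 + 1) Lc, legInd (toSite r) ((Lc : ℤ) • Y + toSite v))) (((Lc : ℝ) ^ (3 + 1)) • wilsonA 3 κ' u')
          + (0 : (Fin 4 → ℤ) → Fin 4 → (Fin 4 → ℤ) → MKer (3 + 1) (Fib 3)) Y κ' u' :=
  hWil_wilson_TW₃ (suGen_complete (ne_zero_of_two_le hN)) (suGen_trOrthonormal N) (ne_zero_of_two_le hN) (diagIndex hN) Lc r hcE₂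

/-- [folklore] `d = 3`, pin `cE₂ = Lc⁸`, colour-free: `hWil''` at `T_W`. -/
theorem hWil''_wilson_TW₃_su (hN : 2 ≤ N) (Lc : ℕ) [NeZero Lc] (r : Fin 4 → ℕ) {cE₂ : ℝ} (hcE₂ : cE₂ = (Lc : ℝ) ^ 8) :
    ∀ (Y : Fin 4 → ℤ) (κ : Fin 4) (u : Fin 4 → ℤ),
      (stepScale 3 Lc 0 * (Lc : ℝ) ^ (3 + 1))⁻¹ • ∑ v ∈ box (3 + 1) Lc,
          divV (fun κ' u' => cE₂ • wilsonW₂ 3 ((8 * (N : ℝ) ^ 2)⁻¹ • wsym22 N) κ u κ' u') ((Lc : ℤ) • Y + toSite v) =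
        comp (((Lc : ℝ) ^ (3 + 1)) • wilsonA 3 κ u) (diagK (((1 : ℝ) / 2) • ∑ v ∈ box (3 + 1) Lc, legInd (toSite r) ((Lc : ℤ) • Y + toSite v)))
          - comp (diagK (((1 : ℝ) / 2) • ∑ v ∈ box (3 + 1) Lc, legInd (toSite r) ((Lc : ℤ) • Y + toSite v))) (((Lc : ℝ) ^ (3 + 1)) • wilsonA 3 κ u)
          + (0 : (Fin 4 → ℤ) → Fin 4 → (Fin 4 → ℤ) → MKer (3 + 1) (Fib 3)) Y κ u :=
  hWil''_wilson_TW₃ (suGen_complete (ne_zero_of_two_le hN)) (suGen_trOrthonormal N) (ne_zero_of_two_le hN) (diagIndex hN) Lc r hcE₂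

end Summit.QuantumFields.BalabanUV.Beta.WilsonWardColourFree
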